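import Literature.Geometry.Kaehler.HolomorphicChainBoundaryRegular
import HarnessLib

/-!
# Normalised holomorphic charts at the regular points of a holomorphic chain

Let `T` be a holomorphic `p`-chain on an open `Ω ⊆ V` and `b` a point of its carrier `reg |T|`.
The straightened chart of `HolomorphicChainRectifiable.lean` (`SCV.IsRegPt.exists_straightParam`:
`Ψ₀ : ball 0 ρ ⊆ K₀ → |T| ∩ N` holomorphic with a linear left inverse `π`) is **normalised** here
by the linear change of parameters `A = DΨ₀(0) : K₀ ≃ K := im DΨ₀(0) = T_b|T|`:

* `HolomorphicChain.exists_normalChart` — there are a complex `p`-plane `K ⊆ V` (the tangent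
  space at `b`), a continuous linear `π₁ : V → K` with `π₁|_K = id`, a radius `ρ > 0`, an open
  `N ∋ b` inside `Ω` and a map `Ψ : K → V`, holomorphic on `ball 0 ρ`, with `Ψ 0 = b`,
  **`DΨ(0) = ι_K`** (the inclusion), `π₁ (Ψ k − b) = k`, `Ψ(ball 0 ρ) ⊆ reg|T|`,
  `reg|T| ∩ N ⊆ Ψ(ball 0 ρ)`, the approximate tangent plane `Tan^{2p}(𝓗^{2p} ⌞ reg|T|, Ψ k)`
  equal to `im DΨ(k)` on the ball, and the density `θ_T` a.e. constant on `reg|T| ∩ N`.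

So near `b` the chain is `k₀` times the graph `k ↦ b + k + v(k)` over its tangent plane `K`, with
`v = Ψ − b − ι` taking values in `ker π₁`, `v(0) = 0`, `Dv(0) = 0` — the starting point of the
blow-up analysis at regular points (Federer 4.3.18, King 1971).

## References

* H. Federer, *Geometric Measure Theory*, Springer 1969, 4.3.18, 3.1.19 [Federer1969].
* E. M. Chirka, *Complex Analytic Sets*, Kluwer 1989, §2.3 (straightening) [Chirka1989].
* R. Harvey, *Holomorphic chains and their boundaries*, PSPUM XXX.1 (1977), §1.4 [Harvey1977].
-/

noncomputable section

open scoped Manifold Topology ENNReal NNReal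
open Set Filter MeasureTheory Metric Function Module TopologicalSpace

namespace Literature.Geometry.Kaehler

namespace HolomorphicChain

open Literature.Geometry.GeometricMeasureTheory

universe u

variable {V : Type u} [NormedAddCommGroup V] [InnerProductSpace ℂ V] [FiniteDimensional ℂ V]
  [MeasurableSpace V] [BorelSpace V] {Ω : Opens V} {p : ℕ}

/-- **Normalised holomorphic chart at a point of the carrier.** See the module docstring.
[cite: Federer1969, 4.3.18; Chirka1989, §2.3; Harvey1977, §1.4] -/
theorem exists_normalChart (T : HolomorphicChain 𝓘(ℂ, V) Ω p) {b : V} (hb : b ∈ T.carrier) :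
    ∃ (K : Submodule ℂ V) (π₁ : V →L[ℂ] K) (ρ : ℝ) (Ψ : K → V) (N : Set V),
      finrank ℂ K = p ∧ (∀ k : K, π₁ (k : V) = k) ∧ 0 < ρ ∧ IsOpen N ∧ b ∈ N ∧
      N ⊆ (Ω : Set V) ∧ DifferentiableOn ℂ Ψ (ball 0 ρ) ∧ Ψ 0 = b ∧
      fderiv ℂ Ψ 0 = K.subtypeL ∧
      (∀ k ∈ ball (0 : K) ρ, π₁ (Ψ k - b) = k) ∧
      (∀ k ∈ ball (0 : K) ρ, Ψ k ∈ T.carrier) ∧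
      T.carrier ∩ N ⊆ Ψ '' ball 0 ρ ∧
      (∀ k ∈ ball (0 : K) ρ,
        approxTangentCone (2 * p) ((μHE[2 * p] : Measure V).restrict T.carrier) (Ψ k) =
          Set.range (fderiv ℂ Ψ k)) ∧
      ∃ k₀ : ℤ, ∀ᵐ y ∂((μHE[2 * p] : Measure V).restrict (T.carrier ∩ N)), T.density y = k₀ := by
  haveI : ProperSpace V := FiniteDimensional.proper ℂ V
  -- a compact neighbourhood of `b` inside `Ω`
  have hbΩ : b ∈ (Ω : Set V) := T.carrier_subset hb
  obtain ⟨ε, hε, hεΩ⟩ := Metric.isOpen_iff.1 Ω.isOpen b hbΩ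
  have hKc : IsCompact (closedBall b (ε / 2)) := isCompact_closedBall _ _
  have hKcΩ : closedBall b (ε / 2) ⊆ (Ω : Set V) :=
    (closedBall_subset_ball (by linarith)).trans hεΩ
  -- the straightened chart
  obtain ⟨hpn, hreg⟩ := T.isRegPt_of_mem_carrier hb
  set Z : Set V := ((↑) : Ω → V) '' T.support with hZ
  have hbZ : b ∈ Z := T.carrier_subset_image_support hb
  obtain ⟨N, g, K₀, π, ρ₀, Ψ₀, hNo, hbN, hNN₀, hg, hgZ, hsurj, hrank, hρ₀, hΨ₀, hΨ₀0, himage, hπ⟩ :=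
    hreg.exists_straightParam hbZ (ball_mem_nhds b (half_pos hε))
  have hK₀p : finrank ℂ K₀ = p := by omega
  have hNKc : N ⊆ closedBall b (ε / 2) := hNN₀.trans ball_subset_closedBall
  have hNΩ : N ⊆ (Ω : Set V) := hNKc.trans hKcΩ
  have hcarN : T.carrier ∩ N = Z ∩ N := T.carrier_inter_eq_of_chart hNo hg hgZ hsurj
  have hballZN : ∀ k ∈ ball (0 : K₀) ρ₀, Ψ₀ k ∈ Z ∩ N := fun k hk =>
    himage ▸ mem_image_of_mem Ψ₀ hk
  have himN : ∀ k ∈ ball (0 : K₀) ρ₀, Ψ₀ k ∈ N := fun k hk => (hballZN k hk).2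
  have hg0 : ∀ k ∈ ball (0 : K₀) ρ₀, g (Ψ₀ k) = 0 := fun k hk =>
    (hgZ _ (hballZN k hk).2).1 (hballZN k hk).1
  -- the linear normalisation `A = DΨ₀(0)`
  set A : K₀ →L[ℂ] V := fderiv ℂ Ψ₀ 0 with hA
  obtain ⟨hπA, hAbd, -⟩ := SCV.straightParam_fderiv hNo hg hsurj hrank hΨ₀ himN hg0 hπ
    (mem_ball_self hρ₀)
  have hAinj : Injective A := by
    intro a c hac
    have := congrArg π hac
    have ha := congrArg (fun f : K₀ →L[ℂ] K₀ => f a) hπA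
    have hc := congrArg (fun f : K₀ →L[ℂ] K₀ => f c) hπA
    simp only [ContinuousLinearMap.comp_apply, ContinuousLinearMap.id_apply] at ha hc
    rw [← ha, ← hc]
    exact congrArg π hac
  set K : Submodule ℂ V := LinearMap.range (A : K₀ →ₗ[ℂ] V) with hKdef
  have hKp : finrank ℂ K = p := by
    rw [hKdef, LinearMap.finrank_range_of_inj hAinj, hK₀p]
  -- `A` as an equivalence `K₀ ≃ K`
  set A' : K₀ ≃L[ℂ] K :=
    (LinearEquiv.ofInjective (A : K₀ →ₗ[ℂ] V) hAinj).toContinuousLinearEquiv with hA'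
  have hA'val : ∀ k₀ : K₀, ((A' k₀ : K) : V) = A k₀ := fun k₀ => rfl
  have hAsymm : ∀ k : K, A (A'.symm k) = (k : V) := fun k => by
    rw [← hA'val, ContinuousLinearEquiv.apply_symm_apply]
  have hπA' : ∀ k₀ : K₀, π (A k₀) = k₀ := fun k₀ => by
    have := congrArg (fun f : K₀ →L[ℂ] K₀ => f k₀) hπA
    simpa using this
  -- radii
  set M : ℝ := ‖(A'.symm : K →L[ℂ] K₀)‖ with hM
  have hM0 : 0 ≤ M := by rw [hM]; exact norm_nonneg (A'.symm : K →L[ℂ] K₀)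
  set ρ : ℝ := ρ₀ / (M + 1) with hρ
  have hρpos : 0 < ρ := div_pos hρ₀ (by linarith)
  have hsymm_ball : ∀ k ∈ ball (0 : K) ρ, A'.symm k ∈ ball (0 : K₀) ρ₀ := by
    intro k hk
    rw [mem_ball_zero_iff] at hk ⊢
    calc ‖A'.symm k‖ ≤ M * ‖k‖ := (A'.symm : K →L[ℂ] K₀).le_opNorm k
      _ ≤ M * ρ := mul_le_mul_of_nonneg_left hk.le hM0
      _ < ρ₀ := by
          rw [hρ, mul_div_assoc']
          rw [div_lt_iff₀ (by linarith)]
          nlinarith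
  set L : ℝ := ‖A‖ * ‖π‖ with hL
  have hL0 : 0 ≤ L := by rw [hL]; exact mul_nonneg (norm_nonneg A) (norm_nonneg π)
  set r₁ : ℝ := ρ / (L + 1) with hr₁
  have hr₁pos : 0 < r₁ := div_pos hρpos (by linarith)
  -- the normalised chart
  set Ψ : K → V := fun k => Ψ₀ (A'.symm k) with hΨdef
  set π₁ : V →L[ℂ] K := (A' : K₀ →L[ℂ] K).comp π with hπ₁
  have hΨd : ∀ k ∈ ball (0 : K) ρ,
      HasFDerivAt Ψ ((fderiv ℂ Ψ₀ (A'.symm k)).comp (A'.symm : K →L[ℂ] K₀)) k := by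
    intro k hk
    have h1 : HasFDerivAt Ψ₀ (fderiv ℂ Ψ₀ (A'.symm k)) (A'.symm k) :=
      (hΨ₀.differentiableAt (isOpen_ball.mem_nhds (hsymm_ball k hk))).hasFDerivAt
    exact h1.comp k (A'.symm : K →L[ℂ] K₀).hasFDerivAt
  refine ⟨K, π₁, ρ, Ψ, N ∩ ball b r₁, hKp, ?_, hρpos, hNo.inter isOpen_ball,
    ⟨hbN, mem_ball_self hr₁pos⟩, inter_subset_left.trans hNΩ, ?_, ?_, ?_, ?_, ?_, ?_, ?_, ?_⟩
  · -- `π₁|_K = id`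
    intro k
    simp only [hπ₁, ContinuousLinearMap.comp_apply, ContinuousLinearEquiv.coe_coe]
    rw [← hAsymm k, hπA', ContinuousLinearEquiv.apply_symm_apply]
  · -- holomorphy
    exact fun k hk => (hΨd k hk).differentiableAt.differentiableWithinAt
  · -- `Ψ 0 = b`
    simp only [hΨdef, map_zero, hΨ₀0]
  · -- `DΨ(0) = ι`
    rw [(hΨd 0 (mem_ball_self hρpos)).fderiv, map_zero]
    ext k
    simp only [ContinuousLinearMap.comp_apply, ContinuousLinearEquiv.coe_coe, Submodule.subtypeL_apply]
    exact hAsymm k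
  · -- left inverse
    intro k hk
    simp only [hπ₁, hΨdef, ContinuousLinearMap.comp_apply, ContinuousLinearEquiv.coe_coe,
      hπ _ (hsymm_ball k hk), ContinuousLinearEquiv.apply_symm_apply]
  · -- into the carrier
    intro k hk
    have h := hballZN _ (hsymm_ball k hk)
    rw [← hcarN] at h
    exact h.1
  · -- coverage near `b`
    rintro y ⟨hy, hyN, hyb⟩
    have hyZN : y ∈ Z ∩ N := by rw [← hcarN]; exact ⟨hy, hyN⟩
    rw [← himage] at hyZN
    obtain ⟨k₀, hk₀, rfl⟩ := hyZN
    refine ⟨A' k₀, ?_, by simp [hΨdef]⟩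
    rw [mem_ball_zero_iff]
    rw [mem_ball, dist_eq_norm] at hyb
    have hk₀n : ‖k₀‖ ≤ ‖π‖ * ‖Ψ₀ k₀ - b‖ := by
      conv_lhs => rw [← hπ k₀ hk₀]
      exact π.le_opNorm _
    calc ‖A' k₀‖ = ‖A k₀‖ := by rw [← hA'val]; rfl
      _ ≤ ‖A‖ * ‖k₀‖ := A.le_opNorm k₀
      _ ≤ ‖A‖ * (‖π‖ * ‖Ψ₀ k₀ - b‖) := mul_le_mul_of_nonneg_left hk₀n (norm_nonneg A)
      _ = L * ‖Ψ₀ k₀ - b‖ := by rw [hL]; ring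
      _ ≤ L * r₁ := mul_le_mul_of_nonneg_left hyb.le hL0
      _ < ρ := by
          rw [hr₁, mul_div_assoc', div_lt_iff₀ (by linarith)]
          nlinarith
  · -- tangent planes
    intro k hk
    have hk₀ := hsymm_ball k hk
    have hcone := T.approxTangentCone_eq_range_of_chart hNo hg hgZ hsurj hrank hK₀p hΨ₀ himage hπ hk₀
    rw [show Ψ k = Ψ₀ (A'.symm k) from rfl, hcone, (hΨd k hk).fderiv, LinearMap.coe_range]
    ext y
    simp only [Set.mem_range, ContinuousLinearMap.coe_coe, ContinuousLinearMap.comp_apply,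
      ContinuousLinearEquiv.coe_coe]
    constructor
    · rintro ⟨k₀, rfl⟩
      exact ⟨A' k₀, by rw [ContinuousLinearEquiv.symm_apply_apply]⟩
    · rintro ⟨k', rfl⟩
      exact ⟨A'.symm k', rfl⟩
  · -- a.e. constant density
    obtain ⟨k₀, hk₀⟩ := T.exists_ae_density_eq_of_chart hNo hg hgZ hsurj hρ₀ hΨ₀ himage hKc hKcΩ hNKc
    refine ⟨k₀, ae_restrict_of_ae_restrict_of_subset ?_ hk₀⟩
    exact inter_subset_inter_right _ inter_subset_left

end HolomorphicChain

end Literature.Geometry.Kaehler
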